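import Literature.NumberTheory.Automorphic.ArchKTypeDescentKirillovGL2Complex
import Literature.NumberTheory.Automorphic.ArchKirillovODEGL2ComplexLowest
import Literature.NumberTheory.Automorphic.ArchWeightVectorRotation
import HarnessLib

/-!
# Shapes of the Kirillov functions at a complex place: the three `S¹`-invariant vectors of a `K`-type
# (Jacquet–Langlands (1970), §6, Thm. 6.2–6.4)

Topic `NumberTheory/Automorphic`; namespace `Literature.NumberTheory.Automorphic`. Theorems only (no
definition, no named fact, no instance). At a COMPLEX place `w` let `x` be a highest-weight Gårding vector of
torus weight `m` (`E_w x = 0`, `τ(T_w) x = im x`), central characters `μ₁`, `μ₂ = iN` on `𝒢`, and let `ℓ` be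
a functional continuous for the `U(𝔤)`-seminorms with `ℓ ∘ τ(E₀₁ ⊗ c_w) = θ₁ ℓ`, `ℓ ∘ τ(E₀₁ ⊗ ic_w) = θ₂ ℓ`.
The Mellin transform over `ℂˣ` against `|z|_ℂ^s` only sees the part of the Kirillov function invariant under
the compact torus `diag(e^{iφ}, 1)_w`, i.e. vectors killed by `τ(E₀₀ ⊗ ic_w)`; this file provides them and
their radial Kirillov functions:

* `torusC_mul_hol01`, `torusC_mul_anti01`, `torusC_pow_apply_of` — `τ^h(E₀₁)` raises and `τ^a(E₀₁)` lowers
  the torus weight by `2`;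
* `gardingEnd_cornerI_apply`, `gardingAct_expGL_cornerI_eq_self` — `τ(E₀₀ ⊗ ic_w) = ½(τ(T_w) + τ(Z^I_w))`, so a
  vector of torus weight `it` with `it + μ₂ = 0` is fixed by the compact torus;
* **case A** (`realShapeC_caseA`): `e = τ^h(E₀₁)^b x`, radial function `c (e^y)^{κ+b} besselMode a ν (e^y)`,
  `κ = (μ₁+m+1)/2`, `λ_a = (μ₁+iμ₂)²/2 - 2ν² - 2`;
* **case B1** (`realShapeC_caseB1`): `e = τ^a(E₀₁)^b F^m x` over the lowest member of the string, radial function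
  `c (e^y)^{κ+b} besselMode a ν' (e^y)`, `λ_h = (μ₁-iμ₂)²/2 - 2ν'² - 2`;
* **case B2** (`realShapeC_caseB2`): `e = F^j x` under the minimal-type relation
  `λ_h = (μ₁-iμ₂)²/2 - 2(ν-im)² - 2`, radial function `c (e^y)^κ besselMode a (ν - ij) (e^y)`
  (`ArchKirillovStringBesselGL2Complex`).

## References

* H. Jacquet, R. P. Langlands, *Automorphic Forms on GL(2)*, LNM 114 (1970), §6 (Thm. 6.2–6.4). [JacquetLanglands1970]
* A. W. Knapp, *Representation Theory of Semisimple Groups* (1986), Ch. II §5, Ch. VIII §3. [Knapp1986]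
-/

noncomputable section

open MeasureTheory Measure NumberField NumberField.InfinitePlace NumberField.mixedEmbedding IsDedekindDomain Set Filter
open scoped MatrixGroups Topology Classical

namespace Literature.NumberTheory.Automorphic

variable {K : Type} [Field K] [NumberField K]

-- as in `ArchGardingWhittaker`
set_option backward.isDefEq.respectTransparency false

section Place

variable {hcpt : isCompact_glFiniteIntegralLevel 2 K}
  {E : Type*} [NormedAddCommGroup E] [NormedSpace ℂ E] [CompleteSpace E]
  {τ : ContRepresentation ℂ (AutomorphyDatum.gl 2 K hcpt).arch.carrier E}
  (hτ : τ.IsStronglyContinuous) (w : {w : InfinitePlace K // IsComplex w})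

local notation "𝐜" => ((0, Pi.single w 1) : mixedSpace K)
local notation "𝐜I" => ((0, Pi.single w Complex.I) : mixedSpace K)
local notation "Hc" => Matrix.single (0 : Fin 2) (0 : Fin 2) ((0, Pi.single w 1) : mixedSpace K)
local notation "D" => gardingEnd (hcpt := hcpt) (τ := τ) hτ
local notation "A[" y "]" => gardingAct (hcpt := hcpt) (τ := τ) hτ (expGL ((y : ℝ) • Hc))
local notation "Dh[" i "," j "]" => (gardingEnd (hcpt := hcpt) (τ := τ) hτ (Matrix.single (i : Fin 2) (j : Fin 2) ((0, Pi.single w 1) : mixedSpace K)) -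
  Complex.I • gardingEnd (hcpt := hcpt) (τ := τ) hτ (Matrix.single (i : Fin 2) (j : Fin 2) ((0, Pi.single w Complex.I) : mixedSpace K)))
local notation "Da[" i "," j "]" => (gardingEnd (hcpt := hcpt) (τ := τ) hτ (Matrix.single (i : Fin 2) (j : Fin 2) ((0, Pi.single w 1) : mixedSpace K)) +
  Complex.I • gardingEnd (hcpt := hcpt) (τ := τ) hτ (Matrix.single (i : Fin 2) (j : Fin 2) ((0, Pi.single w Complex.I) : mixedSpace K)))
local notation "Tc" => (Matrix.single (0 : Fin 2) (0 : Fin 2) ((0, Pi.single w Complex.I) : mixedSpace K) -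
  Matrix.single (1 : Fin 2) (1 : Fin 2) ((0, Pi.single w Complex.I) : mixedSpace K))
local notation "Zc" => (Matrix.single (0 : Fin 2) (0 : Fin 2) ((0, Pi.single w Complex.I) : mixedSpace K) +
  Matrix.single (1 : Fin 2) (1 : Fin 2) ((0, Pi.single w Complex.I) : mixedSpace K))

/-! ### 1. Torus weights of `τ^h(E₀₁)` and `τ^a(E₀₁)` -/

/-- **`[τ(T), τ^h(E₀₁)] = 2i τ^h(E₀₁)`** (from `[T, P⁺] = 2iP⁺`, `[T, E] = 2iE`, `τ^h(E₀₁) = ½(P⁺ + E)`).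
[cite: Knapp1986, Ch. II §5] -/
theorem torusC_mul_hol01 : D Tc * Dh[0,1] = Dh[0,1] * D Tc + (2 * Complex.I) • Dh[0,1] := by
  have hP := torusC_mul_pPlus (hcpt := hcpt) (τ := τ) hτ w
  have hE := torusC_mul_raising (hcpt := hcpt) (τ := τ) hτ w
  rw [← (raisingK_loweringK_eq hτ w).1] at hE
  set P : Module.End ℂ (archGardingSpace hcpt τ) := Dh[0,1] + Da[1,0] with hPdef
  set E' : Module.End ℂ (archGardingSpace hcpt τ) := Dh[0,1] - Da[1,0] with hEdef
  have e : Dh[0,1] = (2 : ℂ)⁻¹ • (P + E') := by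
    rw [hPdef, hEdef, add_add_sub_cancel, ← two_smul ℂ, smul_smul, inv_mul_cancel₀ (two_ne_zero' ℂ), one_smul]
  rw [e, mul_smul_comm, smul_mul_assoc, mul_add, add_mul, hP, hE]
  module

/-- **`[τ(T), τ^a(E₀₁)] = -2i τ^a(E₀₁)`** (from `[T, P⁻] = -2iP⁻`, `[T, F] = -2iF`, `τ^a(E₀₁) = ½(P⁻ - F)`).
[cite: Knapp1986, Ch. II §5] -/
theorem torusC_mul_anti01 : D Tc * Da[0,1] = Da[0,1] * D Tc + (-2 * Complex.I) • Da[0,1] := by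
  have hP := torusC_mul_pMinus (hcpt := hcpt) (τ := τ) hτ w
  have hF := torusC_mul_loweringK (hcpt := hcpt) (τ := τ) hτ w
  set P : Module.End ℂ (archGardingSpace hcpt τ) := Dh[1,0] + Da[0,1] with hPdef
  set F : Module.End ℂ (archGardingSpace hcpt τ) := Dh[1,0] - Da[0,1] with hFdef
  have e : Da[0,1] = (2 : ℂ)⁻¹ • (P - F) := by
    rw [hPdef, hFdef, add_sub_sub_cancel, ← two_smul ℂ, smul_smul, inv_mul_cancel₀ (two_ne_zero' ℂ), one_smul]
  rw [e, mul_smul_comm, smul_mul_assoc, mul_sub, sub_mul, hP, hF]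
  module

omit [CompleteSpace E] in
/-- Weights along a ladder: if `T R = R T + c R` and `T x = a x` then `T (R^j x) = (a + jc) R^j x`. [folklore] -/
theorem torusC_pow_apply_of {T R : Module.End ℂ (archGardingSpace hcpt τ)} {c : ℂ} (hTR : T * R = R * T + c • R)
    {x : archGardingSpace hcpt τ} {a : ℂ} (hx : T x = a • x) (j : ℕ) : T ((R ^ j) x) = (a + j * c) • (R ^ j) x := by
  induction j with
  | zero => simpa using hx
  | succ j ih =>
    rw [pow_succ', Module.End.mul_apply, ← Module.End.mul_apply (f := T), hTR, LinearMap.add_apply, Module.End.mul_apply, ih,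
      map_smul, LinearMap.smul_apply, ← add_smul]
    congr 1
    push_cast
    ring

/-! ### 2. The compact torus `diag(e^{iφ}, 1)_w` -/

/-- `τ(E₀₀ ⊗ ic_w) v = ½(τ(T_w) v + τ(Z^I_w) v)`. [folklore] -/
theorem gardingEnd_cornerI_apply (v : archGardingSpace hcpt τ) :
    D (Matrix.single 0 0 𝐜I) v = (2 : ℂ)⁻¹ • (D Tc v + D Zc v) := by
  rw [gardingEnd_sub, gardingEnd_add, LinearMap.sub_apply, LinearMap.add_apply, sub_add_add_cancel, ← two_smul ℂ, smul_smul,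
    inv_mul_cancel₀ (two_ne_zero' ℂ), one_smul]

/-- **A vector of torus weight `it` with `it + μ₂ = 0` is fixed by the compact torus `diag(e^{iφ}, 1)_w`.**
[cite: JacquetLanglands1970, §6] -/
theorem gardingAct_expGL_cornerI_eq_self {v : archGardingSpace hcpt τ} {t μ₂ : ℂ} (hT : D Tc v = (Complex.I * t) • v)
    (hZ2 : D Zc v = μ₂ • v) (h : Complex.I * t + μ₂ = 0) (φ : ℝ) :
    gardingAct hτ (expGL (φ • Matrix.single (0 : Fin 2) (0 : Fin 2) 𝐜I)) v = v := by
  have h0 : D (Matrix.single 0 0 𝐜I) v = (0 : ℂ) • v := by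
    rw [gardingEnd_cornerI_apply, hT, hZ2, ← add_smul, h, zero_smul, smul_zero]
  have hE : archDerivE hcpt τ (Matrix.single (0 : Fin 2) (0 : Fin 2) 𝐜I) (v : E) = (0 : ℂ) • (v : E) := by
    have h1 := congrArg Subtype.val h0
    rwa [coe_gardingEnd_apply, Submodule.coe_smul] at h1
  refine Subtype.ext ?_
  rw [coe_gardingAct_apply, apply_expGL_smul_eq_exp_smul hτ _ v.2 hE, zero_mul, Complex.exp_zero, one_smul]

/-! ### 3. The three `S¹`-invariant vectors and their radial Kirillov functions -/

/-- `ℓ(τ(exp yH) τ^h(E₀₁)^b v) = ((θ₁ - iθ₂) e^y)^b ℓ(τ(exp yH) v)` and the same for `τ^a(E₀₁)` with `θ₁ + iθ₂`.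
[folklore] -/
theorem apply_gardingAct_hol01_anti01_pow {ℓ : archGardingSpace hcpt τ →ₗ[ℂ] ℂ} {θ₁ θ₂ : ℂ}
    (hθ₁ : ∀ u : archGardingSpace hcpt τ, ℓ (D (Matrix.single 0 1 𝐜) u) = θ₁ * ℓ u)
    (hθ₂ : ∀ u : archGardingSpace hcpt τ, ℓ (D (Matrix.single 0 1 𝐜I) u) = θ₂ * ℓ u)
    (v : archGardingSpace hcpt τ) (y : ℝ) (b : ℕ) :
    ℓ (A[y] ((Dh[0,1] ^ b) v)) = ((θ₁ - Complex.I * θ₂) * (Real.exp y : ℂ)) ^ b * ℓ (A[y] v) ∧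
    ℓ (A[y] ((Da[0,1] ^ b) v)) = ((θ₁ + Complex.I * θ₂) * (Real.exp y : ℂ)) ^ b * ℓ (A[y] v) := by
  induction b with
  | zero => simp
  | succ b ih =>
    obtain ⟨ih1, ih2⟩ := ih
    refine ⟨?_, ?_⟩
    · rw [pow_succ', Module.End.mul_apply, (apply_gardingAct_anti01_hol01 hτ w hθ₁ hθ₂ _ y).2, ih1]
      ring
    · rw [pow_succ', Module.End.mul_apply, (apply_gardingAct_anti01_hol01 hτ w hθ₁ hθ₂ _ y).1, ih2]
      ring

omit [NumberField K] in
/-- `(e^y)^κ (e^y)^b = (e^y)^{κ+b}`. [folklore] -/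
theorem ofReal_exp_cpow_mul_pow (y : ℝ) (κ : ℂ) (b : ℕ) :
    (Real.exp y : ℂ) ^ κ * (Real.exp y : ℂ) ^ b = (Real.exp y : ℂ) ^ (κ + b) := by
  rw [Complex.cpow_add _ _ (Complex.ofReal_ne_zero.mpr (Real.exp_pos y).ne'), Complex.cpow_natCast]

/-- **Case A** (`N ≤ -m`, `b = -(N+m)/2`): the vector `τ^h(E₀₁)^b x` over the highest-weight vector `x` has
torus weight `i(m + 2b)` — so it is fixed by the compact torus when `i(m+2b) + μ₂ = 0` — and radial Kirillov
function `c (e^y)^{(μ₁+m+1)/2 + b} besselMode a ν (e^y)` (`λ_a = (μ₁+iμ₂)²/2 - 2ν² - 2`).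
[cite: JacquetLanglands1970, §6 (Thm. 6.2–6.4)] -/
theorem realShapeC_caseA (hτb : ∀ g, ‖(τ g : E →L[ℂ] E)‖ ≤ 1) {ℓ : archGardingSpace hcpt τ →ₗ[ℂ] ℂ}
    (hℓ : ∃ (C : ℝ) (𝒮 : Finset (List (Matrix (Fin 2) (Fin 2) (mixedSpace K)))), 0 ≤ C ∧
      ∀ v : archGardingSpace hcpt τ, ‖ℓ v‖ ≤ C * ∑ w ∈ 𝒮, ‖archWordDerivE hcpt τ w v‖)
    {θ₁ θ₂ : ℂ} (hθ₁ : ∀ u : archGardingSpace hcpt τ, ℓ (D (Matrix.single 0 1 𝐜) u) = θ₁ * ℓ u)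
    (hθ₂ : ∀ u : archGardingSpace hcpt τ, ℓ (D (Matrix.single 0 1 𝐜I) u) = θ₂ * ℓ u)
    {a : ℝ} (ha : 0 < a) (hθa : (θ₁ + Complex.I * θ₂) * (θ₁ - Complex.I * θ₂) = -((a : ℂ) ^ 2))
    (μ₁ μ₂ m lama ν : ℂ) (hlama : lama = (μ₁ + Complex.I * μ₂) ^ 2 / 2 - 2 * ν ^ 2 - 2)
    (x : archGardingSpace hcpt τ) (hE : (Dh[0,1] - Da[1,0]) x = 0) (hT : D Tc x = (Complex.I * m) • x)
    (hZ1 : D (Matrix.single 0 0 𝐜 + Matrix.single 1 1 𝐜) x = μ₁ • x) (hZ2 : ∀ v : archGardingSpace hcpt τ, D Zc v = μ₂ • v)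
    (hCa : ∑ i : Fin 2, ∑ j : Fin 2, Da[i,j] (Da[j,i] x) = lama • x) (b : ℕ) :
    D Tc ((Dh[0,1] ^ b) x) = (Complex.I * (m + 2 * b)) • (Dh[0,1] ^ b) x ∧
    ∃ c : ℂ, ∀ y : ℝ, ℓ (A[y] ((Dh[0,1] ^ b) x)) =
      c * (Real.exp y : ℂ) ^ ((μ₁ + m + 1) / 2 + b) * besselMode a ν (Real.exp y) := by
  refine ⟨?_, ?_⟩
  · rw [torusC_pow_apply_of (torusC_mul_hol01 hτ w) hT b]
    congr 1; ring
  have hR : D (Matrix.single 0 1 𝐜 - Matrix.single 1 0 𝐜) x - Complex.I • D (Matrix.single 0 1 𝐜I + Matrix.single 1 0 𝐜I) x = 0 := by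
    have h := LinearMap.congr_fun (raisingK_loweringK_eq (hcpt := hcpt) (τ := τ) hτ w).1 x
    rw [hE] at h
    rw [LinearMap.sub_apply, LinearMap.smul_apply] at h
    exact h.symm
  obtain ⟨c, hc⟩ := exists_apply_gardingAct_expGLC_eq_besselMode_of_highest hτ w hτb hℓ hθ₁ hθ₂ ha hθa μ₁ μ₂ m lama ν hlama
    x hR hT hZ1 (hZ2 x) hCa
  refine ⟨c * (θ₁ - Complex.I * θ₂) ^ b, fun y => ?_⟩
  rw [(apply_gardingAct_hol01_anti01_pow hτ w hθ₁ hθ₂ x y b).1, hc y, ← ofReal_exp_cpow_mul_pow, mul_pow]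
  ring

/-- **Case B1** (`N ≥ m`, `b = (N-m)/2`): the vector `τ^a(E₀₁)^b F^m x` over the lowest member `F^m x` of the string
has torus weight `i(-m - 2b)` and radial Kirillov function `c (e^y)^{(μ₁+m+1)/2 + b} besselMode a ν' (e^y)` with
`λ_h = (μ₁-iμ₂)²/2 - 2ν'² - 2` (`ArchKirillovODEGL2ComplexLowest`). [cite: JacquetLanglands1970, §6 (Thm. 6.2–6.4)] -/
theorem realShapeC_caseB1 (hτb : ∀ g, ‖(τ g : E →L[ℂ] E)‖ ≤ 1) {ℓ : archGardingSpace hcpt τ →ₗ[ℂ] ℂ}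
    (hℓ : ∃ (C : ℝ) (𝒮 : Finset (List (Matrix (Fin 2) (Fin 2) (mixedSpace K)))), 0 ≤ C ∧
      ∀ v : archGardingSpace hcpt τ, ‖ℓ v‖ ≤ C * ∑ w ∈ 𝒮, ‖archWordDerivE hcpt τ w v‖)
    {θ₁ θ₂ : ℂ} (hθ₁ : ∀ u : archGardingSpace hcpt τ, ℓ (D (Matrix.single 0 1 𝐜) u) = θ₁ * ℓ u)
    (hθ₂ : ∀ u : archGardingSpace hcpt τ, ℓ (D (Matrix.single 0 1 𝐜I) u) = θ₂ * ℓ u)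
    {a : ℝ} (ha : 0 < a) (hθa : (θ₁ + Complex.I * θ₂) * (θ₁ - Complex.I * θ₂) = -((a : ℂ) ^ 2))
    (μ₁ μ₂ : ℂ) (m : ℕ) (lamh ν' : ℂ) (hlamh : lamh = (μ₁ - Complex.I * μ₂) ^ 2 / 2 - 2 * ν' ^ 2 - 2)
    (x : archGardingSpace hcpt τ) (hT : D Tc x = (Complex.I * m) • x) (hFm : ((Dh[1,0] - Da[0,1]) ^ (m + 1)) x = 0)
    (hZ1 : ∀ v : archGardingSpace hcpt τ, D (Matrix.single 0 0 𝐜 + Matrix.single 1 1 𝐜) v = μ₁ • v)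
    (hZ2 : ∀ v : archGardingSpace hcpt τ, D Zc v = μ₂ • v)
    (hCh : ∀ v : archGardingSpace hcpt τ, ∑ i : Fin 2, ∑ j : Fin 2, Dh[i,j] (Dh[j,i] v) = lamh • v) (b : ℕ) :
    D Tc ((Da[0,1] ^ b) (((Dh[1,0] - Da[0,1]) ^ m) x)) = (Complex.I * (-(m : ℂ) - 2 * b)) • (Da[0,1] ^ b) (((Dh[1,0] - Da[0,1]) ^ m) x) ∧
    ∃ c : ℂ, ∀ y : ℝ, ℓ (A[y] ((Da[0,1] ^ b) (((Dh[1,0] - Da[0,1]) ^ m) x))) =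
      c * (Real.exp y : ℂ) ^ ((μ₁ + m + 1) / 2 + b) * besselMode a ν' (Real.exp y) := by
  -- the lowest member of the string
  have hTm : D Tc (((Dh[1,0] - Da[0,1]) ^ m) x) = (Complex.I * (-(m : ℂ))) • ((Dh[1,0] - Da[0,1]) ^ m) x := by
    rw [torusC_loweringK_pow_apply hτ w m x hT m]
    congr 1; ring
  refine ⟨?_, ?_⟩
  · rw [torusC_pow_apply_of (torusC_mul_anti01 hτ w) hTm b]
    congr 1; ring
  have hF : D (Matrix.single 0 1 𝐜 - Matrix.single 1 0 𝐜) (((Dh[1,0] - Da[0,1]) ^ m) x) +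
      Complex.I • D (Matrix.single 0 1 𝐜I + Matrix.single 1 0 𝐜I) (((Dh[1,0] - Da[0,1]) ^ m) x) = 0 := by
    have h0 : (Dh[1,0] - Da[0,1]) (((Dh[1,0] - Da[0,1]) ^ m) x) = 0 := by
      rw [← Module.End.mul_apply, ← pow_succ', hFm]
    have h := LinearMap.congr_fun (raisingK_loweringK_eq (hcpt := hcpt) (τ := τ) hτ w).2 (((Dh[1,0] - Da[0,1]) ^ m) x)
    rw [h0, LinearMap.sub_apply, LinearMap.neg_apply, LinearMap.smul_apply] at h
    calc D (Matrix.single 0 1 𝐜 - Matrix.single 1 0 𝐜) (((Dh[1,0] - Da[0,1]) ^ m) x) +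
          Complex.I • D (Matrix.single 0 1 𝐜I + Matrix.single 1 0 𝐜I) (((Dh[1,0] - Da[0,1]) ^ m) x)
        = -(-(D (Matrix.single 0 1 𝐜 - Matrix.single 1 0 𝐜) (((Dh[1,0] - Da[0,1]) ^ m) x)) -
            Complex.I • D (Matrix.single 0 1 𝐜I + Matrix.single 1 0 𝐜I) (((Dh[1,0] - Da[0,1]) ^ m) x)) := by abel
      _ = 0 := by rw [← h, neg_zero]
  have hθa' : (θ₁ - Complex.I * θ₂) * (θ₁ + Complex.I * θ₂) = -((a : ℂ) ^ 2) := by rw [mul_comm]; exact hθa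
  obtain ⟨c, hc⟩ := exists_apply_gardingAct_expGLC_eq_besselMode_of_lowest hτ w hτb hℓ hθ₁ hθ₂ ha hθa' μ₁ μ₂ (-(m : ℂ)) lamh ν'
    hlamh _ hF hTm (hZ1 _) (hZ2 _) (hCh _)
  refine ⟨c * (θ₁ + Complex.I * θ₂) ^ b, fun y => ?_⟩
  rw [(apply_gardingAct_hol01_anti01_pow hτ w hθ₁ hθ₂ _ y b).2, hc y, sub_neg_eq_add, ← ofReal_exp_cpow_mul_pow, mul_pow]
  ring

/-- **Case B2** (`|N| < m`, `j = (N+m)/2`, under the minimal-type relation): the string member `F^j x` has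
torus weight `i(m - 2j)` and radial Kirillov function `c' (e^y)^{(μ₁+m+1)/2} besselMode a (ν - ij) (e^y)`
(`ArchKirillovStringBesselGL2Complex.exists_forall_apply_loweringK_pow_eq_besselMode`).
[cite: JacquetLanglands1970, §6 (Thm. 6.2–6.4)] -/
theorem realShapeC_caseB2 (hτb : ∀ g, ‖(τ g : E →L[ℂ] E)‖ ≤ 1) {ℓ : archGardingSpace hcpt τ →ₗ[ℂ] ℂ}
    (hℓ : ∃ (C : ℝ) (𝒮 : Finset (List (Matrix (Fin 2) (Fin 2) (mixedSpace K)))), 0 ≤ C ∧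
      ∀ v : archGardingSpace hcpt τ, ‖ℓ v‖ ≤ C * ∑ w ∈ 𝒮, ‖archWordDerivE hcpt τ w v‖)
    {θ₁ θ₂ : ℂ} (hθ₁ : ∀ u : archGardingSpace hcpt τ, ℓ (D (Matrix.single 0 1 𝐜) u) = θ₁ * ℓ u)
    (hθ₂ : ∀ u : archGardingSpace hcpt τ, ℓ (D (Matrix.single 0 1 𝐜I) u) = θ₂ * ℓ u)
    {a : ℝ} (ha : 0 < a) (hθa : (θ₁ + Complex.I * θ₂) * (θ₁ - Complex.I * θ₂) = -((a : ℂ) ^ 2))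
    (μ₁ μ₂ : ℂ) (m : ℕ) (lama lamh ν : ℂ) (hlama : lama = (μ₁ + Complex.I * μ₂) ^ 2 / 2 - 2 * ν ^ 2 - 2)
    (hlamh : lamh = (μ₁ - Complex.I * μ₂) ^ 2 / 2 - 2 * (ν - Complex.I * m) ^ 2 - 2)
    (x : archGardingSpace hcpt τ) (hE : (Dh[0,1] - Da[1,0]) x = 0) (hT : D Tc x = (Complex.I * m) • x)
    (hZ1 : ∀ v : archGardingSpace hcpt τ, D (Matrix.single 0 0 𝐜 + Matrix.single 1 1 𝐜) v = μ₁ • v)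
    (hZ2 : ∀ v : archGardingSpace hcpt τ, D Zc v = μ₂ • v)
    (hCa : ∑ i : Fin 2, ∑ j : Fin 2, Da[i,j] (Da[j,i] x) = lama • x)
    (hCh : ∀ v : archGardingSpace hcpt τ, ∑ i : Fin 2, ∑ j : Fin 2, Dh[i,j] (Dh[j,i] v) = lamh • v) (j : ℕ) :
    D Tc (((Dh[1,0] - Da[0,1]) ^ j) x) = (Complex.I * ((m : ℂ) - 2 * j)) • ((Dh[1,0] - Da[0,1]) ^ j) x ∧
    ∃ c : ℂ, ∀ y : ℝ, ℓ (A[y] (((Dh[1,0] - Da[0,1]) ^ j) x)) =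
      c * (Real.exp y : ℂ) ^ ((μ₁ + m + 1) / 2) * besselMode a (ν - Complex.I * j) (Real.exp y) := by
  refine ⟨torusC_loweringK_pow_apply hτ w m x hT j, ?_⟩
  obtain ⟨c, hc⟩ := exists_forall_apply_loweringK_pow_eq_besselMode hτ w hτb hℓ hθ₁ hθ₂ ha hθa μ₁ μ₂ m lama lamh ν hlama hlamh
    x hE hT hZ1 hZ2 hCa hCh
  exact ⟨c * ∏ i ∈ Finset.range j, (-2 * ((m : ℂ) - i) * (θ₁ + Complex.I * θ₂) / a), fun y => by rw [hc j y]⟩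

end Place

end Literature.NumberTheory.Automorphic
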